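import Summits.NavierStokesRegularity.NavierStokesRegularity.Theorems.CalmPocketDoorUnit
import Summits.NavierStokesRegularity.NavierStokesRegularity.Theorems.CalmPocketDoorFrame
import HarnessLib

/-!
# CalmPocketDoor — door S32 «CalmPocketDoor» (nsreg-p1 ROUND-30 v2, texts `Theorems/CalmPocketDoorDefs.lean` =
# `r30/Sketch32.lean` v2 d8e333116c9f1838): the PHYSICAL-FRAME closer

`TargetCalmPocket` BY NAME, conditional on the Barker–Prange tree fact
`Literature.Analysis.FluidPDE.barkerPrange2021_regular_of_relative_smallness` (BP21 Prop. 10): the unit-frame door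
`calmPocketRegularity_holds` (`…CalmPocketDoorUnit`: plates F32 `exteriorTraceTube_holds` (nsreg-C26-p1), Q32
`pocketPropagation_holds` (ns-sfl-p1), I32 `terminalValueIdentification_holds` (ns-ezl-w2), BP32 `bp21CalmShellRegularity_of`
(ns-imp-p1)) transported to arbitrary viscosity, window and centre by PT32 `frameTransfer32_holds` (nsreg-C26-p1) — exactly the
Defs composition `targetCalmPocket_of`.

HONEST FRAME: door S32 is the EXTERIOR door — a regularity CRITERION on hypothetical blow-up profiles (Type II allowed in the
core): a terminally ε-calm exterior velocity pocket excludes the apex singularity; it is CONDITIONAL on BP21 Prop. 10 as a named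
tree fact; item 0056 `NoTypeII` stays OPEN; nothing here bears on NS regularity itself.
-/

noncomputable section

set_option linter.dupNamespace false

namespace Summit.NavierStokesRegularity.NavierStokesRegularity.Theorems.CalmPocketDoor

open Literature.Analysis Literature.Analysis.FluidPDE

/-- **DOOR S32 (physical frame) BY NAME, conditional on BP21 Prop. 10**: for every viscosity `ν > 0`, level `M` and
aperture `κ ≤ ½` there are `ε(M, κ) > 0`, `R(M)` such that a Leray–Hopf solution, classical before `T`, whose exterior
pocket is terminally `ε`-calm about `(T, x₀)` at some scale, is regular at `(T, x₀)` — the unit-frame door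
`calmPocketRegularity_holds` carried over by the frame transfer `frameTransfer32_holds` (`targetCalmPocket_of`). -/
theorem targetCalmPocket_holds (h : barkerPrange2021_regular_of_relative_smallness) : TargetCalmPocket :=
  targetCalmPocket_of exteriorTraceTube_holds pocketPropagation_holds terminalValueIdentification_holds
    (bp21CalmShellRegularity_of h) frameTransfer32_holds

end Summit.NavierStokesRegularity.NavierStokesRegularity.Theorems.CalmPocketDoor

end
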